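import Mathlib.NumberTheory.NumberField.CMField
import Mathlib.NumberTheory.NumberField.InfinitePlace.Basic
import HarnessLib

/-!
# Sign prescription in the maximal real subfield of a CM field, read at the complex places (weak approximation at the infinite places)

Topic `NumberTheory/NumberFields`; namespace `Literature.NumberTheory.NumberFields`.  THEOREMS ONLY (no `def`, no instance, no notation, no axiom, no named fact, no `sorry`).
Cell `pub/hodgecm-mathlib`, ENGINE T1 (crux H413 = `stmt-HodgeConjecture-24833`); the (ST-∞) witness road, brick (b5) FILE 1 (F0P3-p03 (g11); F0P3a-p07 (g10) (W7) map §3 (b5),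
LEAD F0P3a-plan (g10) WORD T9-22 (3)).  Count-neutral; HONEST LABEL: HC_CM is proved only modulo the printed citations until rung 0 closes; generic number-field lemma, pays nothing by itself.

WHAT.  For a CM field `L` and prescribed non-zero reals `e_w` at the complex places `w` of `L`, THERE IS `h ∈ L` FIXED BY COMPLEX CONJUGATION (`h ∈ L⁺`) whose embeddings have the
prescribed signs: `0 < Re(σ_w h) · e_w` for every `w` (**`exists_complexConj_eq_re_embedding_mul_pos`**).  Proof: weak approximation at the infinite places (Mathlib
`NumberField.InfinitePlace.denseRange_algebraMap_pi`: `L` is dense in `∏_v (L, |·|_v)`) gives `x ∈ L` with `|x − s_w|_w < 1` for the signs `s_w = ±1`; then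
`h := x + x̄` has `σ_w h = 2 Re σ_w x` (`σ_w x̄ = conj (σ_w x)`, Mathlib `NumberField.IsCMField.complexEmbedding_complexConj`) of the sign of `s_w`.  This is the one number-theoretic
input of the frames on the archimedean stable class ((b5) FILE 2: rational diagonal blocks of prescribed signatures at every place).

## References
* [PlatonovRapinchuk1994] V. Platonov, A. Rapinchuk, *Algebraic Groups and Number Theory* (1994), §1.2 (weak approximation for a number field at finitely many places).
* [Rogawski1990] J. D. Rogawski, *Automorphic Representations of Unitary Groups in Three Variables*, Ann. of Math. Stud. 123 (1990), §3.8 Prop. 3.8.1 (a) p. 27 (where the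
  rational frames it serves are used).
-/

set_option autoImplicit false

noncomputable section

open NumberField NumberField.InfinitePlace

namespace Literature.NumberTheory.NumberFields

/-- **WEAK APPROXIMATION AT THE INFINITE PLACES, UNIT BALLS**: for targets `y_v ∈ L` there is `x ∈ L` with `|x − y_v|_v < 1` at every infinite place `v`
(Mathlib `denseRange_algebraMap_pi` + the open unit ball of the product). [cite: PlatonovRapinchuk1994, §1.2] -/
theorem exists_forall_infinitePlace_sub_lt_one (L : Type) [Field L] [NumberField L] (y : InfinitePlace L → L) :
    ∃ x : L, ∀ v : InfinitePlace L, v (x - y v) < 1 := by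
  classical
  -- the target point of the product `∏_v (L, |·|_v)` and its open unit ball
  let Y : (v : InfinitePlace L) → WithAbs v.1 := fun v => WithAbs.toAbs v.1 (y v)
  obtain ⟨x, hx⟩ := (denseRange_algebraMap_pi L).exists_mem_open Metric.isOpen_ball (⟨Y, Metric.mem_ball_self one_pos⟩ : (Metric.ball Y 1).Nonempty)
  refine ⟨x, fun v => ?_⟩
  have h1 : dist (algebraMap L ((v : InfinitePlace L) → WithAbs v.1) x v) (Y v) < 1 :=
    lt_of_le_of_lt (dist_le_pi_dist _ _ v) (Metric.mem_ball.1 hx)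
  have h2 : algebraMap L ((v : InfinitePlace L) → WithAbs v.1) x v = WithAbs.toAbs v.1 x := rfl
  rw [h2, dist_eq_norm] at h1
  change ‖WithAbs.toAbs v.1 x - WithAbs.toAbs v.1 (y v)‖ < 1 at h1
  rw [← WithAbs.toAbs_sub, WithAbs.norm_toAbs_eq] at h1
  exact h1

/-- **SIGN PRESCRIPTION IN `L⁺` AT THE COMPLEX PLACES OF A CM FIELD.**  For non-zero reals `e_w` indexed by the complex places `w` of the CM field `L` there is `h ∈ L` with
`h̄ = h` (so every `σ_w h` is real) and `0 < Re(σ_w h) · e_w` for all `w` — `σ_w h` has the sign of `e_w`.  (Weak approximation: `x ∈ L` within `1` of `sign e_w` at every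
place; `h := x + x̄`, `σ_w h = 2 Re σ_w x`.) [cite: PlatonovRapinchuk1994, §1.2] -/
theorem exists_complexConj_eq_re_embedding_mul_pos (L : Type) [Field L] [NumberField L] [IsCMField L]
    (e : {w : InfinitePlace L // IsComplex w} → ℝ) (he : ∀ w, e w ≠ 0) :
    ∃ h : L, IsCMField.complexConj L h = h ∧ ∀ w : {w : InfinitePlace L // IsComplex w}, 0 < (w.1.embedding h).re * e w := by
  classical
  -- signs `s_v = ±1 ∈ L` at every place
  let s : InfinitePlace L → L := fun v => if h : IsComplex v then (if 0 < e ⟨v, h⟩ then 1 else -1) else 1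
  obtain ⟨x, hx⟩ := exists_forall_infinitePlace_sub_lt_one L s
  refine ⟨x + IsCMField.complexConj L x, by rw [map_add, IsCMField.complexConj_apply_apply, add_comm], fun w => ?_⟩
  -- `σ_w (x + x̄) = σ_w x + conj (σ_w x)`, real part `2 Re σ_w x`
  have hre : (w.1.embedding (x + IsCMField.complexConj L x)).re = 2 * (w.1.embedding x).re := by
    rw [map_add, IsCMField.complexEmbedding_complexConj, Complex.add_re, Complex.conj_re]; ring
  rw [hre]
  -- `|σ_w x − σ_w s_w| = |x − s_w|_w < 1`
  have hlt : ‖w.1.embedding x - w.1.embedding (s w.1)‖ < 1 := by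
    rw [← map_sub, norm_embedding_eq]; exact hx w.1
  have hre_lt : |(w.1.embedding x).re - (w.1.embedding (s w.1)).re| < 1 :=
    lt_of_le_of_lt (by simpa only [Complex.sub_re] using Complex.abs_re_le_norm (w.1.embedding x - w.1.embedding (s w.1))) hlt
  by_cases hw : 0 < e w
  · have hs : s w.1 = 1 := by simp only [s, dif_pos w.2, if_pos hw]
    rw [hs, map_one, Complex.one_re] at hre_lt
    have : 0 < (w.1.embedding x).re := by
      have := (abs_lt.1 hre_lt).1; linarith
    positivity
  · have hneg : e w < 0 := lt_of_le_of_ne (not_lt.1 hw) (he w)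
    have hs : s w.1 = -1 := by simp only [s, dif_pos w.2, if_neg hw]
    rw [hs, map_neg, map_one, Complex.neg_re, Complex.one_re] at hre_lt
    have : (w.1.embedding x).re < 0 := by
      have := (abs_lt.1 hre_lt).2; linarith
    nlinarith

end Literature.NumberTheory.NumberFields

end
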